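import Summits.Ventures.Crystal3D.Theorems.StickyWulffConstantGenericWallFloorStackLedgerOneSidedDown
import Summits.Ventures.Crystal3D.Theorems.StickyWulffConstantGenericWallFloorStackLedgerOneSidedWide
import HarnessLib

/-!
# The ONE-SIDED stack ledger FROM ABOVE with a WIDE tilted vertical (`‖z + e₃‖ ≤ 1/3`) (crux `GenericWallFloor`, line `WallLedgerG`)

HONEST FRAMING. Venture `Summits/Ventures/Crystal3D` (cell `crystal3d-full`), helper `--supports` the crux `GenericWallFloor`
(stmt-Ventures-19480), registered line `WallLedgerG`, open stub `stub_twoSlabAdhesion`.  Rung credit only; F-C1 not moved; NOT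
the stub.  `twoSlabAdhesion_stackLedger_oneSidedDown_tilt` (19480-p1 g7) VERBATIM with the tilt `1/4 ↦ 1/3` (drift `24(h+40)`,
flux `16000`): grain 2 alone, charge `½κ₂`, no residual, down-slots of `e₃`-component `≤ −9/20` admissible.  NOT the stub.
-/

noncomputable section

namespace Summit.Ventures.Crystal3D.Theorems

open Summit.Ventures.Crystal3D Finset
open Literature.MathematicalPhysics.StatisticalMechanics (fccStacking barlowStacking IsHaggSeq contactDeficiency)
open scoped InnerProductSpace

open scoped Classical in
/-- **The one-sided stack ledger from above with a tilted vertical (grain 2 alone, charge `½κ₂`, no residual).**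
See the module docstring. -/
theorem twoSlabAdhesion_stackLedger_oneSidedDown_wide
    {s₀ : EuclideanSpace ℝ (Fin 3)} (hs₀ : s₀ ∈ fccSlots)
    (hcert : ExactOnly 0 (fccSlots.filter fun w => 0 < ⟪w, s₀⟫_ℝ))
    (hDS : ∀ F₁ F₂ : EuclideanSpace ℝ (Fin 3) ≃ₗᵢ[ℝ] EuclideanSpace ℝ (Fin 3), DoubleStarCoaxialAt F₁ F₂)
    (hCP : CapPairCoaxial)
    (A₁ : EuclideanSpace ℝ (Fin 3) ≃ₗᵢ[ℝ] EuclideanSpace ℝ (Fin 3)) (t₁ : EuclideanSpace ℝ (Fin 3))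
    (A₂ : EuclideanSpace ℝ (Fin 3) ≃ₗᵢ[ℝ] EuclideanSpace ℝ (Fin 3)) (t₂ : EuclideanSpace ℝ (Fin 3))
    {z : EuclideanSpace ℝ (Fin 3)} (hz : ‖z‖ = 1) (hze : ‖z + EuclideanSpace.single (2 : Fin 3) (1 : ℝ)‖ ≤ 1 / 3)
    {u₂ : EuclideanSpace ℝ (Fin 3)} (hu₂ : u₂ ∈ fccSlots)
    (hsteep₂ : Real.sqrt 2 / 2 ≤ ⟪A₂ u₂, z⟫_ℝ)
    (M₂ : Set (EuclideanSpace ℝ (Fin 3) ≃ₗᵢ[ℝ] EuclideanSpace ℝ (Fin 3)))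
    (hM₂ : ∀ stk : List WalkEntry, StackSound z stk → StackWF z stk → stk.getLast? = some ⟨A₂, u₂, 0⟩ →
      ∀ e ∈ stk, e.frame ∈ M₂)
    (hfar : ∀ F ∈ M₂, F '' fccStacking 1 (Real.sqrt (2 / 3)) ≠ A₁ '' fccStacking 1 (Real.sqrt (2 / 3))) :
    ∃ C R₀ : ℝ, 1 ≤ R₀ ∧ ∀ h : ℝ, 0 ≤ h → ∀ ρ : ℝ, R₀ ≤ ρ →
      ∀ X P₁ P₂ : Finset (EuclideanSpace ℝ (Fin 3)),
      (∀ p ∈ X, ∀ q ∈ X, p ≠ q → 1 ≤ dist p q) → P₁ ⊆ X → P₂ ⊆ X \ P₁ →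
      (∀ p ∈ X, -(2 * R₀) ≤ p 2 ∧ p 2 ≤ h + 2 * R₀ ∧ p 0 ^ 2 + p 1 ^ 2 ≤ ρ ^ 2) →
      (∀ p, p ∈ P₁ ↔ (p ∈ (fun q => A₁ q + t₁) '' fccStacking 1 (Real.sqrt (2 / 3)) ∧
        -(2 * R₀) ≤ p 2 ∧ p 2 ≤ -R₀ ∧ p 0 ^ 2 + p 1 ^ 2 ≤ ρ ^ 2)) →
      (∀ p, p ∈ P₂ ↔ (p ∈ (fun q => A₂ q + t₂) '' fccStacking 1 (Real.sqrt (2 / 3)) ∧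
        h + R₀ ≤ p 2 ∧ p 2 ≤ h + 2 * R₀ ∧ p 0 ^ 2 + p 1 ^ 2 ≤ ρ ^ 2)) →
      ((((P₁ ×ˢ (X \ P₁)).filter fun pq => dist pq.1 pq.2 = 1).card : ℕ) : ℝ) +
        ((((P₂ ×ˢ ((X \ P₁) \ P₂)).filter fun pq => dist pq.1 pq.2 = 1).card : ℕ) : ℝ) ≤
        contactDeficiency ((X \ P₁) \ P₂) +
          (Real.sqrt 2 / 4 * ∑ᶠ w ∈ {w ∈ fccStacking 1 (Real.sqrt (2 / 3)) | ‖w‖ = 1},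
              |⟪w, A₁.symm (EuclideanSpace.single (2 : Fin 3) (1 : ℝ))⟫_ℝ| +
            Real.sqrt 2 / 4 * ∑ᶠ w ∈ {w ∈ fccStacking 1 (Real.sqrt (2 / 3)) | ‖w‖ = 1},
              |⟪w, A₂.symm (EuclideanSpace.single (2 : Fin 3) (1 : ℝ))⟫_ℝ| -
            Real.sqrt 2 * |⟪A₂ u₂, EuclideanSpace.single (2 : Fin 3) (1 : ℝ)⟫_ℝ| / 2) * Real.pi * ρ ^ 2 +
          C * (1 + h) * ρ := by
  obtain ⟨C₁, hC₁⟩ := affineSampleDeficit_upper A₁ t₁ 10 (by norm_num)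
  obtain ⟨C₂, hC₂⟩ := affineSampleDeficit_upper A₂ t₂ 10 (by norm_num)
  refine ⟨(240 * Real.sqrt 2 * Real.pi + 4440 * (4 * 10 + 2)) / 2 + 16000 + |C₁| + |C₂|, 10, by norm_num, ?_⟩
  intro h hh ρ hρ X P₁ P₂ hX hP₁X hP₂X hcell hP₁ hP₂
  set e₃ : EuclideanSpace ℝ (Fin 3) := EuclideanSpace.single (2 : Fin 3) (1 : ℝ) with he₃
  have he₃n : ‖e₃‖ = 1 := by rw [he₃, PiLp.norm_single, norm_one]
  have hme₃n : ‖-e₃‖ = 1 := by rw [norm_neg, he₃n]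
  have he₃i : ∀ d : EuclideanSpace ℝ (Fin 3), ⟪d, e₃⟫_ℝ = d 2 := fun d => by rw [he₃, EuclideanSpace.inner_single_right]; simp
  have hze' : ‖z - (-e₃)‖ ≤ 1 / 3 := by rw [sub_neg_eq_add]; exact hze
  -- the `e₃`-drop of the bottom slot under the tilt
  have hu3 : (11 / 30 : ℝ) ≤ ⟪A₂ u₂, -e₃⟫_ℝ := slot_ref_rise_of_tilt_wide hze' A₂ hu₂ hsteep₂
  have hu3' : ⟪A₂ u₂, e₃⟫_ℝ ≤ -(11 / 30) := by rw [inner_neg_right] at hu3; linarith only [hu3]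
  set φ₁ : ℝ := Real.sqrt 2 / 4 * ∑ᶠ w ∈ {w ∈ fccStacking 1 (Real.sqrt (2 / 3)) | ‖w‖ = 1},
      |⟪w, A₁.symm (EuclideanSpace.single (2 : Fin 3) (1 : ℝ))⟫_ℝ| with hφ₁
  set φ₂ : ℝ := Real.sqrt 2 / 4 * ∑ᶠ w ∈ {w ∈ fccStacking 1 (Real.sqrt (2 / 3)) | ‖w‖ = 1},
      |⟪w, A₂.symm (EuclideanSpace.single (2 : Fin 3) (1 : ℝ))⟫_ℝ| with hφ₂
  have hP₂X' : P₂ ⊆ X := hP₂X.trans Finset.sdiff_subset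
  obtain ⟨hρ0, hρ1⟩ : (0 : ℝ) ≤ ρ ∧ (1 : ℝ) ≤ ρ := ⟨by linarith, by linarith⟩
  set L : ℝ := 24 * (h + 4 * 10) with hL; have hL0 : 0 ≤ L := by rw [hL]; positivity
  set Hz : ℝ := ρ + h + 4 * 10 with hHz
  have hHz0 : 0 ≤ Hz := by rw [hHz]; positivity
  set N : ℕ := ⌈6 * Hz + 1⌉₊ with hNdef
  set ρs : ℝ := ρ - 3 - 24 * (h + 4 * 10) with hρs
  set deg : EuclideanSpace ℝ (Fin 3) → ℕ := fun x => (X.filter fun q => dist x q = 1).card with hdeg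
  have hdeg12 : ∀ x, deg x ≤ 12 := fun x => card_filter_dist_eq_one_le_twelve X hX x
  set PAY := X.filter fun y => (X.filter fun q => dist y q = 1).card ≠ 12 ∧
    -10 - 2 ≤ y 2 ∧ y 2 ≤ h + 10 + 2 with hPAY
  -- the weighted interior ledger
  have hled := ledger_ge_faces_add_interior_credits A₁ t₁ A₂ t₂ X P₁ P₂ 10 h ρ le_rfl hh hρ hX hcell hP₁X hP₂X'
    hP₁ hP₂
  rw [← finsum_unit_fcc_symm_eq_sum_slots A₁, ← finsum_unit_fcc_symm_eq_sum_slots A₂, ← hφ₁, ← hφ₂, ← hPAY] at hled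
  -- heights for the tilted vertical and the fuel
  have hH₂ : ∀ q ∈ X, ⟪q, z⟫_ℝ ≤ Hz := fun q hq => by
    have h1 := real_inner_le_norm q z
    rw [hz, mul_one] at h1
    exact h1.trans (norm_le_of_mem_cell (by norm_num) hh hρ0 (hcell q hq))
  have hlowz : ∀ q ∈ X, -Hz ≤ ⟪q, z⟫_ℝ := fun q hq => by
    have h1 := real_inner_le_norm (-q) z
    rw [hz, mul_one, norm_neg, inner_neg_left] at h1
    have h2 := norm_le_of_mem_cell (R₀ := 10) (by norm_num) hh hρ0 (hcell q hq)
    linarith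
  have hN : (6 : ℝ) * Hz + 1 ≤ (N : ℝ) := by rw [hNdef]; exact Nat.le_ceil _
  have hNh_of : ∀ q ∈ X, 8 * (Hz - ⟪q, z⟫_ℝ) < 3 * (N : ℝ) := fun q hq => by
    have := hlowz q hq; linarith
  -- fluxes
  set κ₂ : ℝ := Real.sqrt 2 * |⟪A₂ u₂, e₃⟫_ℝ| with hκ₂
  have hsq : 0 ≤ Real.sqrt 2 := Real.sqrt_nonneg 2; have hπ : Real.pi ≤ 4 := Real.pi_le_four; have hπ0 : 0 ≤ Real.pi := Real.pi_pos.le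
  have hs2' : Real.sqrt 2 ≤ 2 := by
    rw [show (2 : ℝ) = Real.sqrt (2 ^ 2) by rw [Real.sqrt_sq (by norm_num)]]; exact Real.sqrt_le_sqrt (by norm_num)
  have hκ₂0 : 0 ≤ κ₂ := mul_nonneg hsq (abs_nonneg _)
  have hκ₂2 : κ₂ ≤ 2 := by
    have := mul_le_mul hs2' (abs_inner_slot_le_one A₂ hu₂) (abs_nonneg _) (by norm_num); linarith
  -- a first bottom entry, different from grain 2's (the count lemma is used with an EMPTY first family)
  have hu₂0 : A₂ u₂ ≠ 0 := fun h0 => by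
    have := norm_eq_one_of_mem_fccSlots hu₂; rw [← LinearIsometryEquiv.norm_map A₂, h0, norm_zero] at this
    exact zero_ne_one this
  have hbb : (⟨A₂, u₂, A₂ u₂⟩ : WalkEntry) ≠ ⟨A₂, u₂, 0⟩ := fun hb => hu₂0 (congrArg WalkEntry.nrm hb)
  -- the main estimate: the payer sum dominates the tops, up to the flux loss
  have hmain : κ₂ * Real.pi * ρ ^ 2 - 16000 * (1 + h) * ρ ≤
      (∑ y ∈ PAY, ((12 : ℝ) - ((X.filter fun q => dist y q = 1).card : ℝ))) := by
    have hPAY0 : 0 ≤ ∑ y ∈ PAY, ((12 : ℝ) - ((X.filter fun q => dist y q = 1).card : ℝ)) :=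
      Finset.sum_nonneg fun y _ => by
        have h'' : ((X.filter fun q => dist y q = 1).card : ℝ) ≤ 12 := by exact_mod_cast hdeg12 y
        linarith
    by_cases hbig : 11 + L ≤ ρ
    · -- BIG CELL: run the walkers
      have hρs8 : 8 ≤ ρs := by rw [hρs]; linarith
      have hρs0 : 0 ≤ ρs := by linarith
      have hρs17 : ρs + 25 ≤ ρ - 1 := by rw [hρs]; linarith only [hh, hL, hL0]
      have hρsρ : ρs ≤ ρ - 1 := by linarith only [hρs17]
      have hρs2 : ρs ^ 2 ≤ ρ ^ 2 := by nlinarith only [hρs0, hρsρ]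
      have hρs3 : ρs ^ 2 ≤ (ρ - 1) ^ 2 := by nlinarith only [hρs0, hρsρ]
      -- the inner samples, tops and end-state maps
      set S₂ := P₂.filter fun p => (h + 11) ≤ p 2 ∧ p 2 ≤ (h + 11) + 8 ∧ p 0 ^ 2 + p 1 ^ 2 ≤ ρs ^ 2 with hS₂def
      set T₂ := S₂.filter fun p => p + A₂ u₂ ∉ S₂ with hT₂def
      set f₂ : EuclideanSpace ℝ (Fin 3) → EuclideanSpace ℝ (Fin 3) × List WalkEntry :=
        fun p => walkRun X z N (p + A₂ u₂, [⟨A₂, u₂, 0⟩]) with hf₂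
      have hS₂mem : ∀ p, p ∈ S₂ ↔ (p ∈ P₂ ∧ (h + 11) ≤ p 2 ∧ p 2 ≤ (h + 11) + 8 ∧ p 0 ^ 2 + p 1 ^ 2 ≤ ρs ^ 2) :=
        fun p => by rw [hS₂def, Finset.mem_filter]
      have hS₂ : ∀ p, p ∈ S₂ ↔ (p ∈ (fun q => A₂ q + t₂) '' fccStacking 1 (Real.sqrt (2 / 3)) ∧
          (h + 11) ≤ p 2 ∧ p 2 ≤ (h + 11) + 8 ∧ p 0 ^ 2 + p 1 ^ 2 ≤ ρs ^ 2) := by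
        intro p
        rw [hS₂def, Finset.mem_filter, hP₂]
        constructor
        · rintro ⟨⟨hΛ, -, -, -⟩, h1, h2, h3⟩; exact ⟨hΛ, by linarith only [h1], by linarith only [h2], h3⟩
        · rintro ⟨hΛ, h1, h2, h3⟩
          exact ⟨⟨hΛ, by linarith only [h1, hh], by linarith only [h2], by linarith only [h3, hρs2]⟩, h1, h2, h3⟩
      -- the tops count
      obtain ⟨Ea', Eb', hEa', hEb', hdet', hframe', -⟩ := exists_frame_of_mem_fccSlots hu₂
      have hT₂ := tops_ge_lineCount A₂ t₂ (h + 11) 8 ρs (by norm_num) hρs8 S₂ hS₂ Ea' Eb' u₂ hEa' hEb'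
        (norm_eq_one_of_mem_fccSlots hu₂) hdet' hframe'
      have hT₂' : κ₂ * Real.pi * ρs ^ 2 - 10 * Real.sqrt 2 * Real.pi * ρs ≤ (T₂.card : ℝ) := by rw [hT₂def]; exact hT₂
      have hflux : ∀ κ : ℝ, 0 ≤ κ → κ ≤ 2 → κ * Real.pi * ρ ^ 2 - 16000 * (1 + h) * ρ ≤ κ * Real.pi * ρs ^ 2 - 10 * Real.sqrt 2 * Real.pi * ρs :=
        fun κ hκ0 hκ2 => flux_loss_inner_disc_wide hκ0 hκ2 hh hρ0 (by rw [hρs]) hρs0 hρsρ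
      have hT₂'' : κ₂ * Real.pi * ρ ^ 2 - 16000 * (1 + h) * ρ ≤ (T₂.card : ℝ) := le_trans (hflux κ₂ hκ₂0 hκ₂2) hT₂'
      -- lateral bookkeeping
      have hlat_of : ∀ (y₀ y : EuclideanSpace ℝ (Fin 3)) (p : EuclideanSpace ℝ (Fin 3)) (v : EuclideanSpace ℝ (Fin 3)),
          y₀ = p + v → ‖v‖ = 1 → p 0 ^ 2 + p 1 ^ 2 ≤ ρs ^ 2 → ‖y - y₀‖ ≤ L → y 0 ^ 2 + y 1 ^ 2 ≤ (ρ - 2) ^ 2 := by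
        intro y₀ y p v hy₀ hv hp3 hd
        have h1 := sqrt_lateral_add_le y₀ (y - y₀); rw [add_sub_cancel] at h1
        have h2 := sqrt_lateral_add_le p v; rw [hv, ← hy₀] at h2
        have h3 : Real.sqrt (p 0 ^ 2 + p 1 ^ 2) ≤ ρs := by rw [← Real.sqrt_sq hρs0]; exact Real.sqrt_le_sqrt hp3
        have h4 : Real.sqrt (y 0 ^ 2 + y 1 ^ 2) ≤ ρ - 2 := by rw [hρs] at h3; linarith only [h1, h2, h3, hd, hL]
        have h7 := pow_le_pow_left₀ (Real.sqrt_nonneg (y 0 ^ 2 + y 1 ^ 2)) h4 2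
        rwa [Real.sq_sqrt (by positivity : (0 : ℝ) ≤ y 0 ^ 2 + y 1 ^ 2)] at h7
      have hsq_of_sqrt : ∀ (p : EuclideanSpace ℝ (Fin 3)), Real.sqrt (p 0 ^ 2 + p 1 ^ 2) ≤ ρ - 1 →
          p 0 ^ 2 + p 1 ^ 2 ≤ (ρ - 1) ^ 2 := by
        intro p hp
        have h7 := pow_le_pow_left₀ (Real.sqrt_nonneg (p 0 ^ 2 + p 1 ^ 2)) hp 2
        rwa [Real.sq_sqrt (by positivity : (0 : ℝ) ≤ p 0 ^ 2 + p 1 ^ 2)] at h7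
      -- GRAIN 2
      have hfull₂ : ∀ p ∈ S₂, p ∈ X ∧ ∀ w ∈ fccSlots, p + A₂ w ∈ X := by
        intro p hpS
        obtain ⟨hpΛ, hp1, hp2, hp3⟩ := (hS₂ p).1 hpS
        exact ⟨hP₂X' ((hS₂mem p).1 hpS).1, fun w hw => hP₂X' (inner_sample_full_window A₂ t₂ P₂ (h + 10) (h + 2 * 10) ρ
          hρ1 hP₂ hpΛ (by linarith only [hp1]) (by linarith only [hp2]) (by linarith only [hp3, hρs3]) hw)⟩
      have hend₂ : ∀ t ∈ T₂, (f₂ t).1 ∈ PAY ∧ deg (f₂ t).1 ≤ 11 ∧ WalkInv X z (f₂ t) ∧ StackWF z (f₂ t).2 ∧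
          (f₂ t).2.getLast? = some ⟨A₂, u₂, 0⟩ ∧ (∃ e rest, (f₂ t).2 = e :: rest ∧ WalkCertified12 X (f₂ t).1 e) ∧
          ∀ e ∈ (f₂ t).2, e.frame ∈ M₂ := by
        intro p hp
        have hpS : p ∈ S₂ := by rw [hT₂def] at hp; exact (Finset.mem_filter.1 hp).1
        obtain ⟨hpΛ, hp1, hp2, hp3⟩ := (hS₂ p).1 hpS
        obtain ⟨hpX, hfull⟩ := hfull₂ p hpS
        have hy0X : p + A₂ u₂ ∈ X := hfull u₂ hu₂
        have hy02 : (p + A₂ u₂) 2 ≤ h + 20 := by linarith only [(hcell _ hy0X).2.1]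
        have hy02' : -20 ≤ (p + A₂ u₂) 2 := by linarith only [(hcell _ hy0X).1]
        have hNh : 8 * (Hz - ⟪p + A₂ u₂, z⟫_ℝ) < 3 * (N : ℝ) := hNh_of _ hy0X
        have hI₀ : WalkInv X z (p + A₂ u₂, [⟨A₂, u₂, 0⟩]) := walkInv_start A₂ hpX hfull hu₂ hsteep₂
        obtain ⟨hyX, hydeg, -, hcone, -, -⟩ := stackWalk_end hX hs₀ hcert hz hH₂ hI₀ hNh
        have hfw' : walkRun X z N (p + A₂ u₂, [⟨A₂, u₂, 0⟩]) = f₂ p := rfl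
        rw [hfw'] at hyX hydeg hcone
        obtain ⟨hrise, hdisp⟩ := disp_le_of_cone_of_tilt_ref_wide hze' hcone
        have hy0eq : (p + A₂ u₂) 2 = p 2 + ⟪A₂ u₂, e₃⟫_ℝ := by rw [PiLp.add_apply, ← he₃i (A₂ u₂)]
        rw [inner_sub_left, inner_neg_right, inner_neg_right, he₃i, he₃i] at hrise hdisp
        have hy2ge : -20 ≤ (f₂ p).1 2 := by linarith only [(hcell _ hyX).1]
        have hlat2 := hlat_of (p + A₂ u₂) (f₂ p).1 p (A₂ u₂) rfl
          (by rw [LinearIsometryEquiv.norm_map, norm_eq_one_of_mem_fccSlots hu₂]) hp3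
          (by rw [hL]; linarith only [hdisp, hy02, hy2ge])
        have hvalid := walkRun_valid hX hs₀ hcert hz N hI₀ (stackWF_start z A₂ u₂)
        have hlast₂ : (f₂ p).2.getLast? = some ⟨A₂, u₂, 0⟩ := by
          rw [← hfw', walkRun_getLast? hX hs₀ hcert hz N _ hI₀]; rfl
        have hfrM : ∀ e ∈ (f₂ p).2, e.frame ∈ M₂ := hM₂ (f₂ p).2 hvalid.1.2.1 hvalid.2 hlast₂
        have hnotlow := stackWalk_end_not_low_sep hX hs₀ hcert A₁ t₁ P₁ 10 ρ (by linarith only [hρ]) hP₁X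
          (fun q hq => (hcell q hq).1) hP₁ hz hH₂ hI₀ hNh
          (fun e' he' => hfar e'.frame (hfrM e' (by rw [← hfw']; exact he'))) hlat2
        rw [hfw'] at hnotlow
        have hylat : (f₂ p).1 0 ^ 2 + (f₂ p).1 1 ^ 2 ≤ (ρ - 1) ^ 2 := le_trans hlat2 (by nlinarith only [hρ])
        refine ⟨?_, hydeg, hvalid.1, hvalid.2, hlast₂, ?_, hfrM⟩
        · rw [hPAY, Finset.mem_filter]
          refine ⟨hyX, by show deg _ ≠ 12; exact fun h12 => by simp only [hdeg] at h12; omega, ?_, ?_⟩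
          · have : (-10 : ℝ) - 2 < (f₂ p).1 2 := hnotlow
            linarith only [this]
          by_contra hhigh; push Not at hhigh
          exact not_unsaturated_in_slab A₂ t₂ (h + 10) (h + 2 * 10) ρ hρ1 X P₂ hX hP₂X' hP₂ hyX
            (by linarith only [hhigh]) (by linarith only [hrise, hy0eq, hp2, hu3']) hylat hydeg
        · rw [← hfw']
          exact walkRun_certified12 hX hs₀ hcert hz hI₀ ⟨⟨A₂, u₂, 0⟩, [], rfl, Or.inl ⟨by simpa using hpX,
            fun w hw => by simp only [add_sub_cancel_right]; exact hfull w hw⟩⟩ N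
      have hinj₂ : ∀ t ∈ T₂, ∀ t' ∈ T₂, f₂ t = f₂ t' → t = t' := by
        intro t ht t' ht' hft; rw [hT₂def, Finset.mem_filter] at ht ht'
        refine walkRun_start_injective_tilt_ref_wide hX hs₀ hcert hz (-e₃) A₂ t₂ hu₂ hsteep₂ S₂ (hlo := -(h + 19))
          (Hd := -(h + 11)) (ρ' := ρ - 1) hρs0 (fun p hp => ?_) (fun p hp => (hfull₂ p hp).2)
          (fun p hpX hpΛ hlo hhi hlat w hw => ?_) (by linarith only [hρs17])
          (sample_interval A₂ t₂ P₂ S₂ hρs0 (by linarith only [hρsρ]) (by linarith only [hh]) (by linarith only [hh])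
            hP₂ hS₂mem hu₂)
          hze' ht.1 ht.2 ht'.1 ht'.2 hft
        · obtain ⟨hpΛ, hp1, hp2, hp3⟩ := (hS₂ p).1 hp
          refine ⟨(hfull₂ p hp).1, hpΛ, ?_, ?_, hp3⟩
          · rw [inner_neg_right, he₃i]; linarith only [hp2]
          · rw [inner_neg_right, he₃i]; linarith only [hp1]
        · rw [inner_neg_right, he₃i] at hlo hhi
          exact hP₂X' (inner_sample_full_window A₂ t₂ P₂ (h + 10) (h + 2 * 10) ρ hρ1 hP₂ hpΛ (by linarith only [hhi])
            (by linarith only [hlo]) (hsq_of_sqrt p hlat) hw)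
      -- THE COUNT: per payer ball, `deg + #fibre₂ ≤ 12` (the two-family count lemma with an EMPTY first family)
      have hpt : ∀ y ∈ PAY, deg y + (T₂.filter fun t => (f₂ t).1 = y).card ≤ 12 := by
        intro y hy
        set fib₂ := T₂.filter fun t => (f₂ t).1 = y with hfib₂
        by_cases hemp : fib₂ = ∅
        · rw [hemp, Finset.card_empty]; have := hdeg12 y; omega
        -- `y` is an end ball: at most eleven contacts
        have hdegy : deg y ≤ 11 := by
          obtain ⟨t, ht⟩ := Finset.nonempty_iff_ne_empty.2 hemp
          obtain ⟨htT, hty⟩ := Finset.mem_filter.1 ht; have := (hend₂ t htT).2.1; rw [hty] at this; exact this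
        set ES₂ := fib₂.image f₂ with hES₂
        have hc₂ : ES₂.card = fib₂.card := Finset.card_image_of_injOn fun t ht t' ht' hft =>
          hinj₂ t (Finset.mem_filter.1 ht).1 t' (Finset.mem_filter.1 ht').1 hft
        have key := card_contacts_add_endStates_le_twelve_sep hX hDS hCP (∅ : Set _) M₂
          (fun F₁ hF₁ _ _ => absurd hF₁ (Set.notMem_empty F₁)) hbb
          (z₁ := e₃) (z₂ := z) hdegy (∅ : Finset _) ES₂ (fun s hs => absurd hs (Finset.notMem_empty s)) (fun s hs => ?_)
        · rw [hc₂, Finset.card_empty, add_zero] at key; exact key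
        · obtain ⟨t, ht, rfl⟩ := Finset.mem_image.1 hs
          obtain ⟨htT, hty⟩ := Finset.mem_filter.1 ht
          obtain ⟨-, -, hI, hW, hlast, hC, hfr⟩ := hend₂ t htT
          rw [hty] at hC; exact ⟨hty, hI, hW, hlast, hC, hfr⟩
      -- summing over the payers
      have hsum₂ : T₂.card = ∑ y ∈ PAY, (T₂.filter fun t => (f₂ t).1 = y).card := Finset.card_eq_sum_card_fiberwise fun t ht => (hend₂ t ht).1
      have hcount : (T₂.card : ℝ) ≤ ∑ y ∈ PAY, ((12 : ℝ) - ((X.filter fun q => dist y q = 1).card : ℝ)) := by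
        rw [hsum₂]
        push_cast
        refine Finset.sum_le_sum fun y hy => ?_
        have := hpt y hy
        have h' : (deg y : ℝ) + ((T₂.filter fun t => (f₂ t).1 = y).card : ℝ) ≤ 12 := by exact_mod_cast this
        simp only [hdeg] at h'
        linarith
      linarith only [hcount, hT₂'']
    · -- SMALL CELL: the flux is within the error
      push Not at hbig
      have hsmall : κ₂ * Real.pi * ρ ^ 2 ≤ 16000 * (1 + h) * ρ := by
        have h1 : κ₂ * Real.pi ≤ 8 := by nlinarith only [hκ₂0, hκ₂2, hπ, hπ0]
        have h2 : κ₂ * Real.pi * ρ ^ 2 ≤ 8 * ρ ^ 2 := mul_le_mul_of_nonneg_right h1 (sq_nonneg ρ)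
        have h3 : ρ ^ 2 ≤ ρ * (11 + L) := by rw [sq]; exact mul_le_mul_of_nonneg_left hbig.le hρ0
        have hhρ : 0 ≤ h * ρ := mul_nonneg hh hρ0
        rw [hL] at h3; linarith only [h2, h3, hρ0, hhρ]
      linarith only [hsmall, hPAY0]
  -- the two upper slab counts and the two splits
  have hD₁ := hC₁ (-(2 * 10)) (-10) (by ring) ρ hρ P₁ hP₁; have hD₂ := hC₂ (h + 10) (h + 2 * 10) (by ring) ρ hρ P₂ hP₂
  have hsplit₁ := contactDeficiency_sdiff_split hP₁X; have hsplit₂ := contactDeficiency_sdiff_split hP₂X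
  have htwo := two_mul_contactDeficiency_eq_sum X; have hhρ : 0 ≤ h * ρ := mul_nonneg hh hρ0
  -- constants
  have hb : C₁ * ρ ≤ |C₁| * (1 + h) * ρ := by
    have h1 : 0 ≤ (|C₁| - C₁) * ρ := mul_nonneg (by linarith only [le_abs_self C₁]) hρ0
    have h2 : 0 ≤ |C₁| * h * ρ := by positivity
    linarith only [h1, h2]
  have hc' : C₂ * ρ ≤ |C₂| * (1 + h) * ρ := by
    have h1 : 0 ≤ (|C₂| - C₂) * ρ := mul_nonneg (by linarith only [le_abs_self C₂]) hρ0
    have h2 : 0 ≤ |C₂| * h * ρ := by positivity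
    linarith only [h1, h2]
  -- assemble
  set SP : ℝ := ∑ y ∈ PAY, ((12 : ℝ) - ((X.filter fun q => dist y q = 1).card : ℝ)) with hSP
  set C₀ : ℝ := 240 * Real.sqrt 2 * Real.pi + 4440 * (4 * 10 + 2) with hC₀
  have hDX : φ₁ * Real.pi * ρ ^ 2 + φ₂ * Real.pi * ρ ^ 2 + SP / 2 - C₀ * (1 + h) * ρ / 2 ≤ contactDeficiency X := by linarith only [hled, htwo]
  have hcross : ((((P₁ ×ˢ (X \ P₁)).filter fun pq => dist pq.1 pq.2 = 1).card : ℕ) : ℝ) +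
      ((((P₂ ×ˢ ((X \ P₁) \ P₂)).filter fun pq => dist pq.1 pq.2 = 1).card : ℕ) : ℝ) =
      contactDeficiency P₁ + contactDeficiency P₂ + contactDeficiency ((X \ P₁) \ P₂) - contactDeficiency X := by linarith only [hsplit₁, hsplit₂]
  rw [hcross]
  have hSP : κ₂ * Real.pi * ρ ^ 2 / 2 - 8000 * (1 + h) * ρ ≤ SP / 2 := by linarith only [hmain]
  have hC₀0 : 0 ≤ C₀ * (1 + h) * ρ := by positivity
  nlinarith only [hDX, hSP, hD₁, hD₂, hb, hc', hC₀0, hρ0, hh, hhρ]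

end Summit.Ventures.Crystal3D.Theorems

end
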